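import Mathlib
import HarnessLib
import Summits.CriticalPhenomena.Ising3DConformalLimit.Theses.VolterraWard

/-!
# Crux `VolterraWard.WallDecay` (stmt-CriticalPhenomena-11225) — birth skeleton (`Lines/birth.lean`)

Skeleton registrar `planner-skel-stmt-CriticalPhenomena-11225-0`, 2026-08-17 (BC3 of the Lean birth certificate,
route re-audit bin REPAIRABLE). The crux is FIXED: its decl and signature are the route's
(`Theses/VolterraWard.lean`, crux rank 5, "(DECAY) far walls: invisible above, exact transport by the brickwork
map `F` below"); `WallDecay_of` below concludes it BY NAME.

Notation of the crux (its `let` header, repeated verbatim in every stub): `F W M : Site 3 → Site 3` the brickwork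
map (two integer shears of block `W`, Burgers `M`; a bijection of `ℤ³` preserving the height `p 2`);
`C N W M A n y` the free-b.c. critical (`β = β_c(3)`, `h = 0`) Ising correlator `⟨∏ᵢ σ_{yᵢ}⟩` on the TWISTED box
graph on `box 3 N` (planar n.n. bonds in layers `z ≤ A`, `F W M`-pulled-back planar bonds in layers `z > A`,
straight vertical bonds); `D N W M A n y = C N W M A n y − C N W (−M) A n y` the ε-odd (chiral) response;
`W = ⌊w/δ⌋₊`, `M = ⌊εW⌋`, wall at lattice height `A = ⌊a/δ⌋`, insertions `yᵢ = [xᵢ/δ]`, `cc = criticalCorr 3 n`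
the infinite-volume `+`-state critical correlator. The crux is the conjunction
(+) wall far ABOVE `K` ⇒ `|D(⌊a/δ⌋)| ≤ ηε·cc(y)` and (−) wall far BELOW `K` ⇒
`|D(⌊a/δ⌋) − (cc(F_M y) − cc(F_{−M} y))| ≤ ηε·cc(y)`, eventually in the order `a; w, ε, δ → 0; N → ∞`, uniformly on `K`.

## The cut: (+) kept whole ∣ (−) = [far-below wall ≈ wall at −∞] + [fully twisted box → transported `+` state]

The key bookkeeping fact behind the cut: with the wall BELOW THE BOX, `A = −(N+1) < −N ≤ z` for every site of
`box 3 N`, clause (i) of the bond predicate is void and clause (ii) holds in every layer, so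
`C N W M (−(N+1)) n y` is the correlator of the FULLY `F`-pulled-back box graph, which `F × id` maps isomorphically
onto the standard nearest-neighbour graph induced by `ℤ³` on the sheared box `F(box 3 N)` (vertical bonds are
preserved because `F` acts on `(p 0, p 1)` independently of `p 2` and is a bijection there). Hence

* `stub_farAboveInvisible` — (+) verbatim: a twist wall far above all insertions is invisible at `O(ε)`
  (the chiral influence of a far wall decays; "no long-range chiral memory"). Size L (open; the route's kill
  criterion lives here).
* `stub_farBelowToFullTwist` — the (−)-side DECAY statement with the transport divided out: moving a wall that is far
  BELOW all insertions down to `−∞` (i.e. replacing `A = ⌊a/δ⌋` by `A = −(N+1)`, everything twisted) changes the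
  ε-odd response by `≤ ηε·cc(y)`. After pushing forward by `F × id` this is the mirror image of (+) (standard lattice
  above the wall, inverse-twisted below; the refuter's certified isomorphism `bond_{M,A} ↔ bond_{M,−A−1} ∘ Ψ`,
  evidence `Scratch2.lean` on the item) plus the `o(ε)` variation of the far wall's (small, even) influence under the
  `O(ε)` displacement `F_M y ↔ F_{−M} y` of the insertions. Size L (open, same mechanism as (+)).
* `stub_fullTwistTransport` — EXACT TRANSPORT made honest at finite volume: for all `w, ε, δ > 0` and `N → ∞`,
  `C N W (±M) (−(N+1)) n y → cc(F_{±M} y)` within `ηε·cc(y)`, uniformly on compact `K` (finitely many lattice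
  configurations at fixed `δ`). Content: the graph isomorphism above (tree engine:
  `IsingAutomorphismCovariance.isingExpect_fixed_relabel`), insensitivity of the free-b.c. thermodynamic limit to the
  sheared exhaustion `F(box 3 N) ↑ ℤ³` (GKS II monotonicity in the domain, `box(N(1−cε)−c) ⊆ F(box N) ⊆ box(N(1+cε)+c)`),
  and free state = plus state at `β_c(3)` for n-point functions (continuity `m*(β_c)=0`, AizenmanDuminilCopinSidoravicius2015;
  Raoufi2020; tree: `spontaneousMagnetization_criticalBeta_eq_zero_holds`,
  `twoPointFree_eq_twoPointPlus_of_spontaneousMagnetization_eq_zero`); odd `n`: both sides vanish (spin flip /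
  `m*(β_c)=0`), even `n`: `cc(y) > 0` by GKS. Size M (provable with tree engines + a Griffiths-II domain-monotonicity
  lemma on general finite graphs). This is the crux docstring's "(transport identity, provable now)" child.
* `WallDecay_of : stub₁ → stub₂ → stub₃ → WallDecay` — real proof: (+) is stub 1; for (−) the thresholds of stub 2
  (at `η/3`) are threaded through the five quantifier levels, stub 3 (at `η/3`) is invoked at the chosen `w, ε, δ`,
  `N₀ := max`, and the three bounds are combined by the triangle inequality
  `D(A) − (ccF − ccF') = [D(A) − D(−N−1)] + [C_M(−N−1) − ccF] − [C_{−M}(−N−1) − ccF']` (lemma `combine`).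
  `sorry` occurs exactly three times, once inside each `stub_*`; nothing else is sorried.

Disproof used: none exists for this crux (`ledger crux ls stmt-CriticalPhenomena-11225`: no workfiles before this one;
no `Negative/` lemma; `ledger negatives` has no WallDecay entry) — nothing to honour; no stub is an instance of a landed
negative lemma. Refuter crux-attacks (item notes 2026-08-15, three seats): SURVIVES; their structural findings
(`F` bijective, `W = 0 ⇒ F = id`, mirror `M ↦ −M`, the `Ψ` isomorphism onto the wall-far-above family) are exactly
what stubs 2–3 package.
-/

namespace Summit.CriticalPhenomena.Ising3DConformalLimit.Cruxes.WallDecay.Birth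

-- same scoped notations / instances in scope as the route file, so the verbatim `let` headers elaborate to the
-- route's terms (classical decidability of the twisted bond predicate in `SimpleGraph.fromRel`)
open scoped BigOperators Topology Manifold Classical MeasureTheory ProbabilityTheory Matrix InnerProductSpace ComplexConjugate ContinuousMap
open Filter Set Function TopologicalSpace MeasureTheory

/-- STUB 1 — FAR WALL ABOVE IS INVISIBLE AT `O(ε)` (the crux's (+) conjunct, verbatim). For every `n`, compact
`K ⊆ NonCoincident 3 n` and `η > 0` there is `a₀` such that for every wall height `a ≥ a₀`: for `w` small, then `ε`
small, then `δ` small, then `N` large, uniformly in `x ∈ K`, `|D N ⌊w/δ⌋₊ ⌊ε⌊w/δ⌋₊⌋ ⌊a/δ⌋ n [x/δ]| ≤ η·ε·cc([x/δ])`.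
Why plausibly true: in an isotropic scaling limit the rotation twist wall is pure gauge away from insertions and its
`O(ε)` torque on insertions at distance `L ≫ w` is carried by `∫ T_[xy]` over an insertion-free region (zero by
angular-momentum conservation), the lattice remnant decaying like a positive power of `w/L`; fails under long-range
chiral memory (the route's kill criterion). Size: L (open). Leans on: `isingExpect`, `criticalCorr`, `latticeApprox`,
`NonCoincident` (Literature.Probability.LatticeModels). [GeorgiiHiguchi2000, FriedliVelenik2017, CaiNix2016 §14.2] -/
theorem stub_farAboveInvisible : open Literature.Probability.LatticeModels in (let F : ℕ → ℤ → Site 3 → Site 3 := fun W M p i => if i = 0 then p 0 - M * (p 1 / (W : ℤ)) else if i = 1 then p 1 + M * ((p 0 - M * (p 1 / (W : ℤ))) / (W : ℤ)) else p 2; let C : (N W : ℕ) → (M A : ℤ) → (n : ℕ) → (Fin n → Site 3) → ℝ := fun N W M A _n y => isingExpect (SimpleGraph.fromRel fun a b : ↥(box 3 N) => (a.1 2 = b.1 2 ∧ a.1 2 ≤ A ∧ |a.1 0 - b.1 0| + |a.1 1 - b.1 1| = 1) ∨ (a.1 2 = b.1 2 ∧ A < a.1 2 ∧ |F W M a.1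 0 - F W M b.1 0| + |F W M a.1 1 - F W M b.1 1| = 1) ∨ (a.1 0 = b.1 0 ∧ a.1 1 = b.1 1 ∧ |a.1 2 - b.1 2| = 1)) Finset.univ (criticalBeta 3) 0 BoundaryCondition.free (fun s => ∏ i, if h : y i ∈ box 3 N then spinAt (⟨y i, h⟩ : ↥(box 3 N)) s else 0); let D : (N W : ℕ) → (M A : ℤ) → (n : ℕ) → (Fin n → Site 3) → ℝ := fun N W M A n y => C N W M A n y - C N W (-M) A n y; ∀ (n : ℕ) (K : Set (Fin n → EuclideanSpace ℝ (Fin 3))), K ⊆ NonCoincident 3 n → IsCompact K → ∀ η : ℝ, 0 < η → ∃ a₀ : ℝ, ∀ a ≥ a₀, ∃ w₀ > (0 : ℝ), ∀ w ∈ Set.Ioo 0 w₀, ∃ ε₀ > (0 : ℝ), ∀ ε ∈ Set.Ioo 0 ε₀, ∃ δ₀ > (0 : ℝ), ∀ δ ∈ Set.Ioo 0 δ₀, ∃ N₀ : ℕ, ∀ N ≥ N₀, ∀ x ∈ K, |D N ⌊w / δ⌋₊ ⌊ε * ⌊w / δ⌋₊⌋ ⌊a / δ⌋ n (fun i => latticeApprox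 δ (x i))| ≤ η * ε * criticalCorr 3 n (fun i => latticeApprox δ (x i))) := by
  sorry

/-- STUB 2 — A FAR WALL BELOW MAY BE PUSHED TO `−∞` AT `O(ε)` (decay half of the crux's (−) conjunct, transport
divided out). Same quantifier frame as (−) (`∃ a₀, ∀ a ≤ a₀`, then `w, ε, δ → 0`, `N → ∞`, uniformly on `K`):
`|D N W M ⌊a/δ⌋ n y − D N W M (−(N+1)) n y| ≤ η·ε·cc(y)` — the ε-odd response with the wall far below all insertions
differs by `o(ε)` from the ε-odd response of the FULLY twisted box (wall below the box: clause (i) of the bond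
predicate void, clause (ii) in every layer). Pushed forward by the graph isomorphism `F × id` this compares, for
standard-lattice insertions `F_{±M} y`, an inverse-twisted far-below half-space with none: the mirror image of stub 1
(refuter's certified `Ψ`: `bond_{M,A}(a,b) ↔ bond_{M,−A−1}(Ψa,Ψb)`) plus `o(ε)`-regularity of the far wall's small even
influence under the `O(ε)` displacement `F_M y ↔ F_{−M} y`. Why it might fail: exactly the crux's why-line (ε-odd
influence of a wall at distance `|a|` not vanishing after `ε → 0`). Size: L (open). Leans on: as stub 1.
[GeorgiiHiguchi2000, FriedliVelenik2017, CaiNix2016; item evidence Scratch2.lean / WallDecayEvidence.lean] -/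
theorem stub_farBelowToFullTwist : open Literature.Probability.LatticeModels in (let F : ℕ → ℤ → Site 3 → Site 3 := fun W M p i => if i = 0 then p 0 - M * (p 1 / (W : ℤ)) else if i = 1 then p 1 + M * ((p 0 - M * (p 1 / (W : ℤ))) / (W : ℤ)) else p 2; let C : (N W : ℕ) → (M A : ℤ) → (n : ℕ) → (Fin n → Site 3) → ℝ := fun N W M A _n y => isingExpect (SimpleGraph.fromRel fun a b : ↥(box 3 N) => (a.1 2 = b.1 2 ∧ a.1 2 ≤ A ∧ |a.1 0 - b.1 0| + |a.1 1 - b.1 1| = 1) ∨ (a.1 2 = b.1 2 ∧ A < a.1 2 ∧ |F W M a.1 0 - F W M b.1 0| + |F W M a.1 1 - F W M b.1 1| = 1) ∨ (a.1 0 = b.1 0 ∧ a.1 1 = b.1 1 ∧ |a.1 2 - b.1 2| = 1)) Finset.univ (criticalBeta 3) 0 BoundaryCondition.free (fun s => ∏ i, if h : y i ∈ box 3 N then spinAt (⟨y i, h⟩ : ↥(box 3 N)) s else 0); let D : (N W : ℕ) → (M A : ℤ) → (n : ℕ) → (Fin n → Site 3) → ℝ := fun N W M A n y => C N W M A n y -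 C N W (-M) A n y; ∀ (n : ℕ) (K : Set (Fin n → EuclideanSpace ℝ (Fin 3))), K ⊆ NonCoincident 3 n → IsCompact K → ∀ η : ℝ, 0 < η → ∃ a₀ : ℝ, ∀ a ≤ a₀, ∃ w₀ > (0 : ℝ), ∀ w ∈ Set.Ioo 0 w₀, ∃ ε₀ > (0 : ℝ), ∀ ε ∈ Set.Ioo 0 ε₀, ∃ δ₀ > (0 : ℝ), ∀ δ ∈ Set.Ioo 0 δ₀, ∃ N₀ : ℕ, ∀ N ≥ N₀, ∀ x ∈ K, |D N ⌊w / δ⌋₊ ⌊ε * ⌊w / δ⌋₊⌋ ⌊a / δ⌋ n (fun i => latticeApprox δ (x i)) - D N ⌊w / δ⌋₊ ⌊ε * ⌊w / δ⌋₊⌋ (-((N : ℤ) + 1)) n (fun i => latticeApprox δ (x i))| ≤ η * ε * criticalCorr 3 n (fun i => latticeApprox δ (x i))) := by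
  sorry

/-- STUB 3 — FULL-TWIST TRANSPORT (the crux docstring's "transport identity, provable now" child, stated honestly at
finite volume). For all `w, ε, δ > 0` (no smallness needed: `F W M` is a bijection of `ℤ³` for every `W, M`, and
`F = id` when `W = 0` or `M = 0`) and every compact `K`: for `N` large, uniformly in `x ∈ K`,
`|C N W (±M) (−(N+1)) n y − cc(F_{W,±M} ∘ y)| ≤ η·ε·cc(y)` (`y = [x/δ]`, both signs). Content: (a) the fully pulled-back
box graph is isomorphic under `F × id` to the nearest-neighbour graph of `ℤ³` induced on the sheared box `F(box 3 N)`,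
so `C N W M (−(N+1)) n y = ⟨∏σ_{F yᵢ}⟩^free_{F(box N)}` (`isingExpect_fixed_relabel`); (b) `F(box N) ↑ ℤ³` is an
exhaustion sandwiched between centred boxes, so by Griffiths II (monotonicity of free-b.c. correlators in the domain)
these converge to the free infinite-volume state; (c) free = plus at `β_c(3)` (`m*(β_c) = 0`, ADS2015 / Raoufi2020), i.e.
the limit is `cc(F y)`; (d) at fixed `δ` only finitely many `y` arise from `x ∈ K`, and `cc(y) > 0` for even `n` (GKS),
while for odd `n` both sides vanish identically — so pointwise convergence gives the uniform `ηε·cc(y)` tolerance.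
Why it might fail: only if free-box limits on the sheared exhaustion failed to reach the plus state at `β_c` (excluded by
continuity of the transition; the residual risk named in the crux's why-line). Size: M. Leans on: `isingExpect`,
`criticalCorr` (= `plusExpect … (spinMonomial ·)`), `IsingAutomorphismCovariance`, `hasBoxLimit_isingCorr_free_holds`,
`spontaneousMagnetization_criticalBeta_eq_zero_holds` (Literature.Probability.LatticeModels).
[FriedliVelenik2017 §3.6–3.10, AizenmanDuminilCopinSidoravicius2015, Raoufi2020, GeorgiiHiguchi2000] -/
theorem stub_fullTwistTransport : open Literature.Probability.LatticeModels in (let F : ℕ → ℤ → Site 3 → Site 3 := fun W M p i => if i = 0 then p 0 - M * (p 1 / (W : ℤ)) else if i = 1 then p 1 + M * ((p 0 - M * (p 1 / (W : ℤ))) / (W : ℤ)) else p 2; let C : (N W : ℕ) → (M A : ℤ) → (n : ℕ) → (Fin n → Site 3) → ℝ := fun N W M A _n y => isingExpect (SimpleGraph.fromRel fun a b : ↥(box 3 N) => (a.1 2 = b.1 2 ∧ a.1 2 ≤ A ∧ |a.1 0 - b.1 0| + |a.1 1 - b.1 1| = 1) ∨ (a.1 2 = b.1 2 ∧ A < a.1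 2 ∧ |F W M a.1 0 - F W M b.1 0| + |F W M a.1 1 - F W M b.1 1| = 1) ∨ (a.1 0 = b.1 0 ∧ a.1 1 = b.1 1 ∧ |a.1 2 - b.1 2| = 1)) Finset.univ (criticalBeta 3) 0 BoundaryCondition.free (fun s => ∏ i, if h : y i ∈ box 3 N then spinAt (⟨y i, h⟩ : ↥(box 3 N)) s else 0); ∀ (n : ℕ) (K : Set (Fin n → EuclideanSpace ℝ (Fin 3))), K ⊆ NonCoincident 3 n → IsCompact K → ∀ η : ℝ, 0 < η → ∀ w : ℝ, 0 < w → ∀ ε : ℝ, 0 < ε → ∀ δ : ℝ, 0 < δ → ∃ N₀ : ℕ, ∀ N ≥ N₀, ∀ x ∈ K, |C N ⌊w / δ⌋₊ ⌊ε * ⌊w / δ⌋₊⌋ (-((N : ℤ) + 1)) n (fun i => latticeApprox δ (x i)) - criticalCorr 3 n (fun i => F ⌊w / δ⌋₊ ⌊ε * ⌊w / δ⌋₊⌋ (latticeApprox δ (x i)))| ≤ η * ε * criticalCorr 3 n (fun i => latticeApprox δ (x i)) ∧ |C N ⌊w / δ⌋₊ (-⌊ε * ⌊w / δ⌋₊⌋)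 (-((N : ℤ) + 1)) n (fun i => latticeApprox δ (x i)) - criticalCorr 3 n (fun i => F ⌊w / δ⌋₊ (-⌊ε * ⌊w / δ⌋₊⌋) (latticeApprox δ (x i)))| ≤ η * ε * criticalCorr 3 n (fun i => latticeApprox δ (x i))) := by
  sorry

/-! ## Registered stub statements as named propositions (verbatim copies, keyed by the stub names; the
hypotheses of the composition `WallDecay_of`) -/
namespace Registered

/-- registered statement of `stub_farAboveInvisible` (verbatim). -/
abbrev stub_farAboveInvisible : Prop := open Literature.Probability.LatticeModels in (let F : ℕ → ℤ → Site 3 → Site 3 := fun W M p i => if i = 0 then p 0 - M * (p 1 / (W : ℤ)) else if i = 1 then p 1 + M * ((p 0 - M * (p 1 / (W : ℤ))) / (W : ℤ)) else p 2; let C : (N W : ℕ) → (M A : ℤ) → (n : ℕ) → (Fin n → Site 3) → ℝ := fun N W M A _n y => isingExpect (SimpleGraph.fromRel fun a b : ↥(box 3 N) => (a.1 2 = b.1 2 ∧ a.1 2 ≤ A ∧ |a.1 0 - b.1 0| + |a.1 1 - b.1 1| = 1) ∨ (a.1 2 = b.1 2 ∧ A < a.1 2 ∧ |F W M a.1 0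 - F W M b.1 0| + |F W M a.1 1 - F W M b.1 1| = 1) ∨ (a.1 0 = b.1 0 ∧ a.1 1 = b.1 1 ∧ |a.1 2 - b.1 2| = 1)) Finset.univ (criticalBeta 3) 0 BoundaryCondition.free (fun s => ∏ i, if h : y i ∈ box 3 N then spinAt (⟨y i, h⟩ : ↥(box 3 N)) s else 0); let D : (N W : ℕ) → (M A : ℤ) → (n : ℕ) → (Fin n → Site 3) → ℝ := fun N W M A n y => C N W M A n y - C N W (-M) A n y; ∀ (n : ℕ) (K : Set (Fin n → EuclideanSpace ℝ (Fin 3))), K ⊆ NonCoincident 3 n → IsCompact K → ∀ η : ℝ, 0 < η → ∃ a₀ : ℝ, ∀ a ≥ a₀, ∃ w₀ > (0 : ℝ), ∀ w ∈ Set.Ioo 0 w₀, ∃ ε₀ > (0 : ℝ), ∀ ε ∈ Set.Ioo 0 ε₀, ∃ δ₀ > (0 : ℝ), ∀ δ ∈ Set.Ioo 0 δ₀, ∃ N₀ : ℕ, ∀ N ≥ N₀, ∀ x ∈ K, |D N ⌊w / δ⌋₊ ⌊ε * ⌊w / δ⌋₊⌋ ⌊a / δ⌋ n (fun i => latticeApprox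 δ (x i))| ≤ η * ε * criticalCorr 3 n (fun i => latticeApprox δ (x i)))

/-- registered statement of `stub_farBelowToFullTwist` (verbatim). -/
abbrev stub_farBelowToFullTwist : Prop := open Literature.Probability.LatticeModels in (let F : ℕ → ℤ → Site 3 → Site 3 := fun W M p i => if i = 0 then p 0 - M * (p 1 / (W : ℤ)) else if i = 1 then p 1 + M * ((p 0 - M * (p 1 / (W : ℤ))) / (W : ℤ)) else p 2; let C : (N W : ℕ) → (M A : ℤ) → (n : ℕ) → (Fin n → Site 3) → ℝ := fun N W M A _n y => isingExpect (SimpleGraph.fromRel fun a b : ↥(box 3 N) => (a.1 2 = b.1 2 ∧ a.1 2 ≤ A ∧ |a.1 0 - b.1 0| + |a.1 1 - b.1 1| = 1) ∨ (a.1 2 = b.1 2 ∧ A < a.1 2 ∧ |F W M a.1 0 - F W M b.1 0| + |F W M a.1 1 - F W M b.1 1| = 1) ∨ (a.1 0 = b.1 0 ∧ a.1 1 = b.1 1 ∧ |a.1 2 - b.1 2| = 1)) Finset.univ (criticalBeta 3) 0 BoundaryCondition.free (fun s => ∏ i, if h : y i ∈ box 3 N then spinAt (⟨y i, h⟩ :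 ↥(box 3 N)) s else 0); let D : (N W : ℕ) → (M A : ℤ) → (n : ℕ) → (Fin n → Site 3) → ℝ := fun N W M A n y => C N W M A n y - C N W (-M) A n y; ∀ (n : ℕ) (K : Set (Fin n → EuclideanSpace ℝ (Fin 3))), K ⊆ NonCoincident 3 n → IsCompact K → ∀ η : ℝ, 0 < η → ∃ a₀ : ℝ, ∀ a ≤ a₀, ∃ w₀ > (0 : ℝ), ∀ w ∈ Set.Ioo 0 w₀, ∃ ε₀ > (0 : ℝ), ∀ ε ∈ Set.Ioo 0 ε₀, ∃ δ₀ > (0 : ℝ), ∀ δ ∈ Set.Ioo 0 δ₀, ∃ N₀ : ℕ, ∀ N ≥ N₀, ∀ x ∈ K, |D N ⌊w / δ⌋₊ ⌊ε * ⌊w / δ⌋₊⌋ ⌊a / δ⌋ n (fun i => latticeApprox δ (x i)) - D N ⌊w / δ⌋₊ ⌊ε * ⌊w / δ⌋₊⌋ (-((N : ℤ) + 1)) n (fun i => latticeApprox δ (x i))| ≤ η * ε * criticalCorr 3 n (fun i => latticeApprox δ (x i)))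

/-- registered statement of `stub_fullTwistTransport` (verbatim). -/
abbrev stub_fullTwistTransport : Prop := open Literature.Probability.LatticeModels in (let F : ℕ → ℤ → Site 3 → Site 3 := fun W M p i => if i = 0 then p 0 - M * (p 1 / (W : ℤ)) else if i = 1 then p 1 + M * ((p 0 - M * (p 1 / (W : ℤ))) / (W : ℤ)) else p 2; let C : (N W : ℕ) → (M A : ℤ) → (n : ℕ) → (Fin n → Site 3) → ℝ := fun N W M A _n y => isingExpect (SimpleGraph.fromRel fun a b : ↥(box 3 N) => (a.1 2 = b.1 2 ∧ a.1 2 ≤ A ∧ |a.1 0 - b.1 0| + |a.1 1 - b.1 1| = 1) ∨ (a.1 2 = b.1 2 ∧ A < a.1 2 ∧ |F W M a.1 0 - F W M b.1 0| + |F W M a.1 1 - F W M b.1 1| = 1) ∨ (a.1 0 = b.1 0 ∧ a.1 1 = b.1 1 ∧ |a.1 2 - b.1 2| = 1)) Finset.univ (criticalBeta 3) 0 BoundaryCondition.free (fun s => ∏ i, if h : y i ∈ box 3 N then spinAt (⟨y i, h⟩ : ↥(box 3 N)) s else 0); ∀ (n : ℕ) (K : Set (Fin n → EuclideanSpace ℝ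 (Fin 3))), K ⊆ NonCoincident 3 n → IsCompact K → ∀ η : ℝ, 0 < η → ∀ w : ℝ, 0 < w → ∀ ε : ℝ, 0 < ε → ∀ δ : ℝ, 0 < δ → ∃ N₀ : ℕ, ∀ N ≥ N₀, ∀ x ∈ K, |C N ⌊w / δ⌋₊ ⌊ε * ⌊w / δ⌋₊⌋ (-((N : ℤ) + 1)) n (fun i => latticeApprox δ (x i)) - criticalCorr 3 n (fun i => F ⌊w / δ⌋₊ ⌊ε * ⌊w / δ⌋₊⌋ (latticeApprox δ (x i)))| ≤ η * ε * criticalCorr 3 n (fun i => latticeApprox δ (x i)) ∧ |C N ⌊w / δ⌋₊ (-⌊ε * ⌊w / δ⌋₊⌋) (-((N : ℤ) + 1)) n (fun i => latticeApprox δ (x i)) - criticalCorr 3 n (fun i => F ⌊w / δ⌋₊ (-⌊ε * ⌊w / δ⌋₊⌋) (latticeApprox δ (x i)))| ≤ η * ε * criticalCorr 3 n (fun i => latticeApprox δ (x i)))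

end Registered

/-- The arithmetic of the (−) half: `D(A) − (ccF − ccF') = [D(A) − (R − S)] + [R − ccF] − [S − ccF']` with
`R = C_M(−N−1)`, `S = C_{−M}(−N−1)`, and three `η/3` bounds add up. -/
theorem combine {X R S G G' η ε c : ℝ}
    (hA : |X - (R - S)| ≤ η / 3 * ε * c) (hB : |R - G| ≤ η / 3 * ε * c) (hC : |S - G'| ≤ η / 3 * ε * c) :
    |X - (G - G')| ≤ η * ε * c := by
  have h1 : |X - (G - G')| ≤ |X - (R - S)| + |(R - S) - (G - G')| := abs_sub_le X (R - S) (G - G')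
  have h2 : |(R - S) - (G - G')| ≤ |R - G| + |S - G'| := by
    calc |(R - S) - (G - G')| = |(R - G) - (S - G')| := by ring_nf
      _ ≤ |R - G| + |S - G'| := abs_sub (R - G) (S - G')
  linarith

/-- ASSEMBLY (kernel-checked, no sorry): the three stubs imply the crux, literally the route decl
`Summit.CriticalPhenomena.Ising3DConformalLimit.Theses.VolterraWard.WallDecay`. (+) is stub 1. For (−): given
`n, K, η`, take `a₀` and, level by level, the thresholds `w₀, ε₀, δ₀, N₁` of stub 2 at tolerance `η/3`; at the chosen
`w, ε, δ > 0` stub 3 at `η/3` gives `N₂`; for `N ≥ max N₁ N₂` and `x ∈ K` the three bounds combine (`combine`). -/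
theorem WallDecay_of (h₁ : Registered.stub_farAboveInvisible) (h₂ : Registered.stub_farBelowToFullTwist)
    (h₃ : Registered.stub_fullTwistTransport) :
    Summit.CriticalPhenomena.Ising3DConformalLimit.Theses.VolterraWard.WallDecay := by
  unfold Summit.CriticalPhenomena.Ising3DConformalLimit.Theses.VolterraWard.WallDecay
  refine ⟨h₁, ?_⟩
  intro n K hK hKc η hη
  have hη3 : 0 < η / 3 := by positivity
  obtain ⟨a₀, ha⟩ := h₂ n K hK hKc (η / 3) hη3
  refine ⟨a₀, fun a haa => ?_⟩
  obtain ⟨w₀, hw₀, hw⟩ := ha a haa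
  refine ⟨w₀, hw₀, fun w hwI => ?_⟩
  obtain ⟨ε₀, hε₀, hε⟩ := hw w hwI
  refine ⟨ε₀, hε₀, fun ε hεI => ?_⟩
  obtain ⟨δ₀, hδ₀, hδ⟩ := hε ε hεI
  refine ⟨δ₀, hδ₀, fun δ hδI => ?_⟩
  obtain ⟨N₁, hN₁⟩ := hδ δ hδI
  obtain ⟨N₂, hN₂⟩ := h₃ n K hK hKc (η / 3) hη3 w hwI.1 ε hεI.1 δ hδI.1
  refine ⟨max N₁ N₂, fun N hN x hx => ?_⟩
  have hA := hN₁ N (le_of_max_le_left hN) x hx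
  obtain ⟨hB, hC⟩ := hN₂ N (le_of_max_le_right hN) x hx
  exact combine hA hB hC

/-- Plugging the registered (sorried) stubs into the assembly type-checks: the `Registered` aliases ARE the stub
statements, and the skeleton proves the crux modulo exactly the three stubs. -/
example : Summit.CriticalPhenomena.Ising3DConformalLimit.Theses.VolterraWard.WallDecay :=
  WallDecay_of stub_farAboveInvisible stub_farBelowToFullTwist stub_fullTwistTransport

end Summit.CriticalPhenomena.Ising3DConformalLimit.Cruxes.WallDecay.Birth
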